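import Summits.NavierStokesRegularity.NavierStokesRegularity.Theorems.NoOverheating.Negative.ExcludedStrataCensusV9
import Summits.NavierStokesRegularity.NavierStokesRegularity.Theorems.NoOverheating.Negative.ExtraFactorsTendingToOneExcluded

/-!
# KJ-62c — CENSUS v10 of the excluded strata of route `AngularGalerkinLadder`'s window sequences
# ((S0)–(S21) of `excludedStrata_windowSequences_v9` + (S22) extra plain self-similarity with
# factors tending to one — discrete self-similarity cannot degenerate towards continuous)

Refuter lineage, Negative lane of crux K2 `NoOverheating` (supports, does not decide).  Pure
assembly — this file proves NOTHING new: it folds kernel row KJ-62b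
(`ExtraFactorsTendingToOneExcluded`) into the census statement of record,
`excludedStrata_windowSequences_v10`, "what an admissible window sequence of K2 can NOT be":

* (S22) for some factors `1 < σₙ → 1`, the `n`-th profile is in addition plainly `σₙ`-DSS
  (`σₙ uₙ(σₙ² t, σₙ x) = uₙ(t, x)`): the integer powers of `σₙ` densify in `(0, ∞)`, the identity
  passes to the ladder limit by the JOINT space–time convergence on compact cylinders
  (`…LadderLimitJoint.exists_ladderLimit_joint`), the cut-off limit is `λ`-DSS for every `λ`, in
  particular for one in Chae–Wolf's fine range, and Chae–Wolf 2017 Thm. 1.3 removes it,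
  `…ExtraFactorsTendingToOneExcluded.no_windowSequence_extraFactors_tendsto_one`.

Census sentence after v10: as v9, and moreover the supply's self-similarity must stay GENUINELY
DISCRETE at a scale ratio bounded away from one along the ladder ((S5) was the constant-factor
case in the fine range; (S22) is the degenerating case, any window, any rotations).
[cite: ChaeWolf2017RemovingDSS, Theorem 1.3 (arXiv:1610.09464 p. 3)]
[cite: KochNadirashviliSereginSverak2009, Lemma 6.1 (limits of rescaled solutions)] -/

namespace Summit.NavierStokesRegularity.AngularGalerkinLadderExcludedStrataCensusV10

open Set Filter MeasureTheory Topology Function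
open scoped ENNReal
open Literature.Analysis Literature.Analysis.FluidPDE
open Summit.NavierStokesRegularity.FluidComputer
open Summit.NavierStokesRegularity.NavierStokesRegularity.Theses.AngularGalerkinLadder
open Summit.NavierStokesRegularity.AngularGalerkinLadderExcludedStrataCensusV9
open Summit.NavierStokesRegularity.AngularGalerkinLadderExtraFactorsTendingToOneExcluded

/-- **Census theorem v10: the excluded strata (S0)–(S22) of K2's window sequences.**  As
`excludedStrata_windowSequences_v9`, plus (S22): extra plain `σₙ`-self-similarity of the `n`-th
profile with `1 < σₙ → 1` — for ANY `C₀`, ANY window `1 < cmin ≤ cmax` and ANY rotations.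
[cite: ChaeWolf2017RemovingDSS, Theorem 1.3 (arXiv:1610.09464 p. 3)] -/
theorem excludedStrata_windowSequences_v10 :
    ∃ ε₀ : ℝ, 0 < ε₀ ∧ ∀ C₀ : ℝ, ∃ κ α₁ c₁ α₂ c₂ lam₁ β₁ β₂ : ℝ,
      1 < κ ∧ 0 < α₁ ∧ 1 < c₁ ∧ 0 < α₂ ∧ 1 < c₂ ∧ 1 < lam₁ ∧ 0 < β₁ ∧ 0 < β₂ ∧
      ∀ {cmin cmax δ : ℝ} {L : ℕ → ℕ} {ε c : ℕ → ℝ}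
        {R : ℕ → (EuclideanSpace ℝ (Fin 3) ≃ₗᵢ[ℝ] EuclideanSpace ℝ (Fin 3))}
        {u : ℕ → ℝ → EuclideanSpace ℝ (Fin 3) → EuclideanSpace ℝ (Fin 3)}
        {p : ℕ → ℝ → EuclideanSpace ℝ (Fin 3) → ℝ}
        {d : ℕ → ℝ → EuclideanSpace ℝ (Fin 3) → EuclideanSpace ℝ (Fin 3)},
        1 < cmin → 0 < δ → Tendsto ε atTop (𝓝 0) →
        (∀ n, AngularLadder.IsWindowProfile (L n) C₀ cmin cmax δ (ε n) (c n) (R n) (u n) (p n)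
          (d n)) →
        ¬ (C₀ ≤ ε₀ ∨
           (∀ n, ∀ t < 0, IsAxisymmetric (u n t)) ∨
           (∃ q : ℕ, 0 < q ∧ cmax ^ q < κ ∧
              ∀ x, Tendsto (fun n => ((R n) ^ q) x) atTop (𝓝 x)) ∨
           (∃ (q : ℕ) (g : ℕ → (EuclideanSpace ℝ (Fin 3) ≃ₗᵢ[ℝ] EuclideanSpace ℝ (Fin 3)))
              (θ : ℕ → ℝ),
              0 < q ∧ cmax ^ q < c₁ ∧ (∀ n x, ((R n) ^ q) x = g n (rotZ (θ n) ((g n).symm x))) ∧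
              ∀ n, |θ n| ≤ 2 * α₁ * (q * Real.log (c n))) ∨
           (∃ (Θ ℓ : ℝ) (g : ℕ → (EuclideanSpace ℝ (Fin 3) ≃ₗᵢ[ℝ] EuclideanSpace ℝ (Fin 3)))
              (θ : ℕ → ℝ),
              ℓ < Real.log c₂ ∧ (∀ n x, R n x = g n (rotZ (θ n) ((g n).symm x))) ∧
              (∀ n, |θ n| ≤ Θ) ∧ (∀ n, 2 * α₂ * Real.log (c n) ≤ |θ n|) ∧
              ∀ n, (1 + (θ n / (2 * Real.log (c n))) ^ 2) * Real.log (c n) ≤ ℓ) ∨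
           (∃ lam : ℝ, 1 < lam ∧ lam < lam₁ ∧ ∀ n, IsDiscretelySelfSimilar lam (u n)) ∨
           (∀ n, IsSelfSimilar (u n)) ∨
           (∃ (g : ℕ → (EuclideanSpace ℝ (Fin 3) ≃ₗᵢ[ℝ] EuclideanSpace ℝ (Fin 3))) (α : ℕ → ℝ),
              (∀ n (μ : ℝ), 1 < μ → IsRotatedDSS μ
                (((g n).symm.trans (rotZLIE (2 * α n * Real.log μ))).trans (g n)) (u n)) ∧
              ∀ n, |α n| ≤ β₁ ∨ β₂ ≤ |α n|) ∨
           (∃ M : ℝ≥0∞, M < ⊤ ∧ ∀ n, eLpNorm (u n (-1)) 3 volume ≤ M) ∨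
           (∃ M : ℝ≥0∞, M < ⊤ ∧ ∀ n, eLpNorm (u n (-1)) 2 volume ≤ M) ∨
           (∀ η : ℝ, 0 < η → ∃ ρ : ℝ, ∀ n x, ρ ≤ ‖x‖ → ‖x‖ * ‖u n (-1) x‖ ≤ η) ∨
           (∀ n, ∀ t < 0, ∃ e : EuclideanSpace ℝ (Fin 3), ∀ x,
              curl (u n t) x = ‖curl (u n t) x‖ • e) ∨
           (∀ n, ∃ (d₀ : ℝ) (η : ℝ → ℝ), Tendsto η (𝓝[>] 0) (𝓝 0) ∧
              ∀ s ∈ Ioo (-1 : ℝ) 0, ∀ x y, d₀ < ‖curl (u n s) x‖ → d₀ < ‖curl (u n s) y‖ →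
                ‖vorticityDirection (curl (u n s)) x - vorticityDirection (curl (u n s)) y‖ ≤
                  η ‖x - y‖) ∨
           (∃ (n : ℕ) (S : EuclideanSpace ℝ (Fin 3) ≃ₗᵢ[ℝ] EuclideanSpace ℝ (Fin 3))
              (b : EuclideanSpace ℝ (Fin 3)), S b = b ∧ b ≠ 0 ∧
              ∀ x, ‖u n (-1) (S x + b)‖ = ‖u n (-1) x‖) ∨
           (∃ (n : ℕ) (ρ B : ℝ), 0 < ρ ∧
              ∀ z ∈ parabolicCylinder ρ (0 : ℝ × EuclideanSpace ℝ (Fin 3)), ‖u n z.1 z.2‖ ≤ B) ∨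
           (∃ (n : ℕ) (U : EuclideanSpace ℝ (Fin 3) → EuclideanSpace ℝ (Fin 3)),
              Continuous U ∧ ∀ t < 0, u n t = U) ∨
           (∃ (n : ℕ) (e : EuclideanSpace ℝ (Fin 3)), ∀ x, ∃ a : ℝ,
              curl (u n (-1)) x = a • e) ∨
           (∃ (n : ℕ) (d₀ : ℝ) (η : ℝ → ℝ), Tendsto η (𝓝[>] 0) (𝓝 0) ∧
              ∀ s ∈ Ioo (-1 : ℝ) 0, ∀ x y, d₀ < ‖curl (u n s) x‖ → d₀ < ‖curl (u n s) y‖ →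
                min ‖vorticityDirection (curl (u n s)) x - vorticityDirection (curl (u n s)) y‖
                    ‖vorticityDirection (curl (u n s)) x + vorticityDirection (curl (u n s)) y‖ ≤
                  η ‖x - y‖) ∨
           (∃ (n : ℕ) (ρ M : ℝ), 0 < ρ ∧
              ∀ z ∈ parabolicCylinder ρ (0 : ℝ × EuclideanSpace ℝ (Fin 3)),
                ‖curl (u n z.1) z.2‖ ≤ M) ∨
           (∃ (n : ℕ) (e : EuclideanSpace ℝ (Fin 3)) (ρ M : ℝ), (R n e = e ∨ R n e = -e) ∧
              0 < ρ ∧ ∀ z ∈ parabolicCylinder ρ (0 : ℝ × EuclideanSpace ℝ (Fin 3)),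
                ∃ a : ℝ, ‖u n z.1 z.2 - a • e‖ ≤ M) ∨
           (∃ (n : ℕ) (e : EuclideanSpace ℝ (Fin 3)) (ρ M : ℝ), (R n e = e ∨ R n e = -e) ∧
              0 < ρ ∧ ∀ z ∈ parabolicCylinder ρ (0 : ℝ × EuclideanSpace ℝ (Fin 3)),
                ∃ a : ℝ, ‖curl (u n z.1) z.2 - a • e‖ ≤ M) ∨
           (∃ (n : ℕ) (S : EuclideanSpace ℝ (Fin 3) ≃ₗᵢ[ℝ] EuclideanSpace ℝ (Fin 3))
              (b : EuclideanSpace ℝ (Fin 3)), S b = b ∧ b ≠ 0 ∧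
              ∀ x, ‖u n (-1) x‖ ≤ ‖u n (-1) (S x + b)‖) ∨
           (∃ A : ℕ → (EuclideanSpace ℝ (Fin 3) ≃ₗᵢ[ℝ] EuclideanSpace ℝ (Fin 3)),
              ∀ θ, ∀ t < 0, ∀ x,
                Tendsto (fun n => (A n).symm (u n t (A n (rotZ θ x))) -
                  rotZ θ ((A n).symm (u n t (A n x)))) atTop (𝓝 0)) ∨
           (∃ (S : EuclideanSpace ℝ (Fin 3) ≃ₗᵢ[ℝ] EuclideanSpace ℝ (Fin 3))
              (b : EuclideanSpace ℝ (Fin 3)), S b = b ∧ b ≠ 0 ∧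
              ∀ x, Tendsto (fun n => ‖u n (-1) (S x + b)‖ - ‖u n (-1) x‖) atTop (𝓝 0)) ∨
           (∀ s < 0, ∀ t < 0, ∀ x, Tendsto (fun n => u n t x - u n s x) atTop (𝓝 0)) ∨
           (∃ (A : ℕ → (EuclideanSpace ℝ (Fin 3) ≃ₗᵢ[ℝ] EuclideanSpace ℝ (Fin 3))) (α : ℕ → ℝ),
              Tendsto α atTop (𝓝 0) ∧ (∀ n, α n ≠ 0) ∧ ∀ n, ∀ t < 0, ∀ x,
                (A n).symm (u n t (A n (rotZ (α n) x))) =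
                  rotZ (α n) ((A n).symm (u n t (A n x)))) ∨
           (∃ σ : ℕ → ℝ, (∀ n, 1 < σ n) ∧ Tendsto σ atTop (𝓝 1) ∧
              ∀ n, IsDiscretelySelfSimilar (σ n) (u n))) := by
  obtain ⟨ε₀, hε₀, H⟩ := excludedStrata_windowSequences_v9
  refine ⟨ε₀, hε₀, fun C₀ => ?_⟩
  obtain ⟨κ, α₁, c₁, α₂, c₂, lam₁, β₁, β₂, hκ, hα₁, hc₁, hα₂, hc₂, hlam₁, hβ₁, hβ₂, HC⟩ := H C₀
  refine ⟨κ, α₁, c₁, α₂, c₂, lam₁, β₁, β₂, hκ, hα₁, hc₁, hα₂, hc₂, hlam₁, hβ₁, hβ₂,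
    fun {cmin cmax δ L ε c R u p d} hcmin hδ hε hW => ?_⟩
  have HC' := HC hcmin hδ hε hW
  simp only [not_or] at HC' ⊢
  obtain ⟨h0, h1, h2, h3, h4, h5, h6, h7, h8, h9, h10, h11, h12, h13, h14, h15, h16, h17, h18, h19,
    h20, h21, h22, h23, h24, h25⟩ := HC'
  exact ⟨h0, h1, h2, h3, h4, h5, h6, h7, h8, h9, h10, h11, h12, h13, h14, h15, h16, h17, h18, h19,
    h20, h21, h22, h23, h24, h25,
    fun ⟨σ, hσ1, hσ, hss⟩ =>
      no_windowSequence_extraFactors_tendsto_one hcmin hδ hε hW σ hσ1 hσ hss⟩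

end Summit.NavierStokesRegularity.AngularGalerkinLadderExcludedStrataCensusV10
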